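import Literature.Computability.AlgebraicComplexity.IK2020ContentSubspaceProofs
import Literature.Computability.AlgebraicComplexity.IK2020OrbitClosureInvariantBound
import Literature.Computability.AlgebraicComplexity.YoungWreathSliceCharacter
import HarnessLib

/-!
# Ikenmeyer–Kandasamy 2020, Prop. 10.1, part P1: `dim ({λ}^{Dϱ})^{stab ϱ}` is the
# `[λ]`-multiplicity of the slice space of content `Dϱ` (transport to the word model)

Topic `Literature/Computability/AlgebraicComplexity` (val-lit cell, board U1 =
`IK2020_prop_10_1`, part **P1a + plumbing** of the fact-free route recorded in
`HOME/bip/NOTE-t08g3-IK2020Prop101-route.md`, ROUTE B). Theorems only: no definitions, no named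
facts.

Source: C. Ikenmeyer, U. Kandasamy, *Implementing geometric complexity theory: On the separation
of orbit closures via symmetries*, STOC 2020 = arXiv:1911.03990 [IkenmeyerKandasamy2019], §10,
proof of Prop. 10.1 (TeX L850–896; held text `paper:arxiv-1911.03990` p0016): "`dim ({λ}_ϱ)^{𝔖_m}
= dim ({λ}^ϱ)^{stab ϱ}`" (Claim 10.2, the tree's `IK2020_claim_10_2_holds`) "… which by Schur–Weyl
duality equals the dimension of the `stab ϱ`-invariants … `{λ}^ϱ ≃ [λ]^{G_ϱ}` [ike:12b, 4.3(A)]".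
This file proves the Schur–Weyl step in the tree's word model: for a partition `λ ⊢ n`, an
alphabet `[m]` and a content vector `γ : [m] → ℕ` with `|γ| = n`,

  `n! · dim ({λ}^γ)^{stab γ} = ∑_{τ ∈ 𝔖_n} χ^λ(τ) χ_γ(τ)`
  (`factorial_mul_finrank_permFixed_weightSpace_eq_sum`),

where `{λ} = weylRep k (Fin m) λ` is Weyl's construction `c_λ · (k^m)^{⊗n}`, `{λ}^γ` its weight
space of weight `γ`, `({λ}^γ)^{stab γ}` the vectors fixed by the permutation matrices `P_π`,
`γ ∘ π = γ` (IK's `permFixed`), and `χ_γ` is the `𝔖_n`-character of the **slice space**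
`sliceSpace k m n γ` of `YoungWreathSliceCharacter.lean` (functions on words `[n] → [m]` supported
on the words of content `γ` and invariant under relabellings in `stab γ`). With val-lit t08's
`sum_spechtCharacter_mul_character_sliceSpace_eq_finrank_invariants` (the permutation character of
`𝔖_n / K_γ`, `K_γ ≅ ∏_i 𝔖_{ρ̂_i} ≀ 𝔖_{iD}`) and Claim 10.2 this gives, for IK's data
`γ = D·ϱ`, `n = dD`:

  `dim ({λ}_ϱ)^{𝔖_m} = dim (HW_λ((ℂ^N)^{⊗dD}))^{K_γ(w₀)}`
  (`IK2020.finrank_permFixed_contentSubspace_eq_finrank_invariants`, any word `w₀` of content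
  `D·ϱ`, any `N ≥ ℓ(λ)`),

so that the named fact `IK2020_prop_10_1` is reduced to the purely symmetric-group statement
`dim (HW_λ)^{K_γ(w₀)} = b(λ,ϱ,D,d)` (part P2 of the route note):
`IK2020_prop_10_1_of_finrank_invariants_eq_bCoeff`.

## Proof (route B of the note)

Along the coordinate isomorphism `wordCoord : (k^m)^{⊗n} ≃ (words → k)` (which intertwines
`glTensorRep`/`wordRep` and `permTensorRep`/`wordPerm`, `wordCoord_glTensorRep`, t08's
`wordCoord_asAlgebraHom_permTensorRep`): the Weyl module `{λ} = c_λ · (k^m)^{⊗n}` goes to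
`W_λ = c_λ · (words → k)`; a vector of the sub-representation `weylRep` has weight `γ` iff its
image is supported on the words of content `γ` (t08's `mem_weightSpace_wordRep_iff_support`: the
diagonal torus acts on `e_w` by `∏ t_i^{cont_i(w)}`, and contents are separated in characteristic
zero); it is fixed by `P_π`, `π ∈ stab γ`, iff its image is
relabel-invariant (t08's `mem_sliceSpace_iff_forall_wordRep_eq`). Hence
`wordCoord (({λ}^γ)^{stab γ}) = W_λ ⊓ X_γ` with `X_γ = sliceSpace`, and `W_λ ⊓ X_γ = c_λ · X_γ`
because `c_λ` preserves the `𝔖_n`-stable `X_γ` and `c_λ v = n_λ v` on `W_λ` (`c_λ² = n_λ c_λ`,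
`youngSymmetrizer_sq`, `n_λ ≠ 0`). Finally `n! · dim (c_λ · X_γ) = ∑_τ χ^λ(τ) χ_{X_γ}(τ)` is the
rank formula for Young symmetrizers (`factorial_mul_finrank_range_youngSymmetrizer`,
Fulton–Harris Lemma 4.26).

Honest framing: finite-dimensional linear algebra / classical Schur–Weyl bookkeeping for IK's toy
model; nothing here bears on VP versus VNP, which is NOT proved.

## References

* [IkenmeyerKandasamy2019] C. Ikenmeyer, U. Kandasamy, arXiv:1911.03990, §10 (Prop. 10.1,
  Claim 10.2).
* [FultonHarrisGTM129] W. Fulton, J. Harris, *Representation Theory*, GTM 129, Lemma 4.26,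
  §6.1 Lemma 6.22, Thm. 6.3 (Schur–Weyl), §15.3 (weights).
* [Ikenmeyer2012thesis] C. Ikenmeyer, PhD thesis (2012), 4.3(A) (`{λ}^ϱ ≃ [λ]^{G_ϱ}`; cited by IK
  as [ike:12b]; not held — the proof here is the tree's own).

## Tree

`IK2020.permFixed`, `IK2020.contentSubspace`, `IK2020.permGL`, `IK2020.bCoeff`, `IK2020_prop_10_1`
(`IK20HighestWeightVectors`); `IK2020_claim_10_2_holds`, `IK2020.coe_permGL` (`IK2020ContentSubspaceProofs`);
`factorial_mul_finrank_range_youngSymmetrizer` (`IK2020OrbitClosureInvariantBound`); `sliceSpace`,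
`mem_sliceSpace_iff`, `sliceSpace_le_comap`, `mem_sliceSpace_iff_forall_wordRep_eq`,
`sum_spechtCharacter_mul_character_sliceSpace_eq_finrank_invariants` (`YoungWreathSliceCharacter`);
`weylModule`, `weylRep`, `permTensorRep`, `glTensorRep`, `wordCoord`, `wordCoord_glTensorRep`,
`wordRep`, `wordPerm`, `wordPermRep`, `wordContent`, `apply_eq_zero_of_mem_weightSpace`,
`weightSpace`, `weightChar`, `youngSymmetrizer_sq`, `coeff_sq_youngSymmetrizer_ne_zero`,
`coe_eq_diagonal_of_isDiagonalGL`, `Weight.size_ofPartition_holds`.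
-/

noncomputable section

open scoped BigOperators

namespace Literature.Computability.AlgebraicComplexity

open _root_.Literature.NumberTheory.DiophantineGeometry

/-! ### §1 The coordinate isomorphism and the two actions -/

section Transport

variable (k : Type*) [Field k] {m n : ℕ}

/-- Coordinates of the permutation action: `wordCoord (τ · v) = τ · wordCoord v` — a private copy
of t08's `wordCoord_permTensorRep_apply` (`YoungWreathSliceCharacter.lean` §7, landed minutes
before this file; kept local so that this file elaborates on farm nodes that have not yet rebuilt
that module). [folklore] -/
private theorem wordCoord_permTensorRep_apply_local (τ : Equiv.Perm (Fin n))
    (v : TensorPower k n (Fin m → k)) :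
    wordCoord k m n (permTensorRep k (Fin m → k) n τ v) = wordPerm k τ (wordCoord k m n v) := by
  funext w
  rw [wordPerm_apply, wordCoord_eq_repr, wordCoord_eq_repr, tensorBasis_repr_permTensorRep]

/-- Coordinates of the group-algebra action: `wordCoord (a · v) = a · wordCoord v` for
`a ∈ k[𝔖_n]` — a private copy of t08's `wordCoord_asAlgebraHom_permTensorRep`
(`YoungWreathSliceCharacter.lean` §7; same reason as above). [folklore] -/
private theorem wordCoord_asAlgebraHom_permTensorRep_local (a : MonoidAlgebra k (Equiv.Perm (Fin n)))
    (v : TensorPower k n (Fin m → k)) :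
    wordCoord k m n ((permTensorRep k (Fin m → k) n).asAlgebraHom a v) =
      (wordPermRep k m n).asAlgebraHom a (wordCoord k m n v) := by
  induction a using MonoidAlgebra.induction_on with
  | hM τ =>
    rw [Representation.asAlgebraHom_of, Representation.asAlgebraHom_of, wordPermRep_apply,
      wordCoord_permTensorRep_apply_local]
  | hadd a b ha hb =>
    rw [map_add, map_add, LinearMap.add_apply, LinearMap.add_apply, map_add, ha, hb]
  | hsmul r a ha =>
    rw [map_smul, map_smul, LinearMap.smul_apply, LinearMap.smul_apply, map_smul, ha]

/-- The group algebra acts on a sub-representation by restriction of its action on the ambient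
module (coercion lemma). [folklore] -/
private theorem coe_subrepresentation_asAlgebraHom {G V : Type*} [Group G] [AddCommGroup V]
    [Module k V] (ρ : Representation k G V) (W : Submodule k V) (hW : ∀ g, W ≤ W.comap (ρ g))
    (a : MonoidAlgebra k G) (x : W) :
    (((ρ.subrepresentation W hW).asAlgebraHom a x : W) : V) = ρ.asAlgebraHom a (x : V) := by
  induction a using MonoidAlgebra.induction_on with
  | hM g =>
    rw [Representation.asAlgebraHom_of, Representation.asAlgebraHom_of,
      Representation.subrepresentation_apply, LinearMap.coe_restrict_apply]
  | hadd a b ha hb =>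
    rw [map_add, map_add, LinearMap.add_apply, LinearMap.add_apply, Submodule.coe_add, ha, hb]
  | hsmul r a ha =>
    rw [map_smul, map_smul, LinearMap.smul_apply, LinearMap.smul_apply, Submodule.coe_smul, ha]

/-- **A diagonal matrix acts on the coordinate model diagonally**: `(t · y)(w) =
(∏_i t_{ii}^{cont_i(w)}) · y(w)` (`e_w` is a weight vector of weight `cont(w)`; Fulton,
*Young Tableaux* §8.2; Fulton–Harris §15.3). [cite: FultonHarrisGTM129, §15.3] -/
theorem wordRep_apply_of_isDiagonalGL {t : GL (Fin m) k} (ht : IsDiagonalGL t)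
    (y : Word m n → k) (w : Word m n) :
    wordRep k m n t y w =
      (∏ i, (t : Matrix (Fin m) (Fin m) k) i i ^ wordContent w i) * y w := by
  have hdiag := coe_eq_diagonal_of_isDiagonalGL ht
  rw [wordRep_apply, Finset.sum_eq_single w,
    ← prod_eq_prod_pow_wordContent (fun i => (t : Matrix (Fin m) (Fin m) k) i i) w]
  · intro w' _ hw'
    obtain ⟨p, hp⟩ := Function.ne_iff.1 hw'
    rw [Finset.prod_eq_zero (Finset.mem_univ p), zero_mul]
    rw [hdiag, Matrix.diagonal_apply_ne _ (Ne.symm hp)]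
  · intro h
    exact absurd (Finset.mem_univ w) h

/-- Weight vectors of the coordinate model are the functions supported on the words of the given
content (characteristic zero) — a private copy of t08's `mem_weightSpace_wordRep_iff_support`
(`YoungWreathSliceCharacter.lean` §6, landed minutes before this file; kept local so that this
file elaborates on farm nodes that have not yet rebuilt that module). [folklore] -/
private theorem mem_weightSpace_wordRep_iff_support_local [CharZero k] (γ : Fin m → ℕ)
    (y : Word m n → k) :
    y ∈ weightSpace (wordRep k m n) (fun i => (γ i : ℤ)) ↔
      ∀ u : Word m n, wordContent u ≠ γ → y u = 0 := by
  constructor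
  · intro hy u hu
    obtain ⟨i, hi⟩ := Function.ne_iff.1 hu
    exact apply_eq_zero_of_mem_weightSpace k hy (i := i) (by exact_mod_cast hi)
  · intro hy t ht
    funext w
    rw [Pi.smul_apply, smul_eq_mul, wordRep_apply_of_isDiagonalGL k ht]
    by_cases hw : wordContent w = γ
    · rw [weightChar]
      congr 1
      refine Finset.prod_congr rfl fun i _ => ?_
      rw [← hw, zpow_natCast]
    · rw [hy w hw, mul_zero, mul_zero]

/-- A vector of the Weyl representation `{λ} ⊆ (k^m)^{⊗n}` has weight `χ` iff the underlying
tensor has (the sub-representation acts by restriction). [folklore] -/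
private theorem mem_weightSpace_weylRep_iff (lam : Nat.Partition n) (χ : Weight (Fin m))
    (v : weylModule k (Fin m) lam) :
    v ∈ weightSpace (V := weylModule k (Fin m) lam) (weylRep k (Fin m) lam) χ ↔
      (v : TensorPower k n (Fin m → k)) ∈ weightSpace (glTensorRep (Fin m) k n) χ := by
  rw [mem_weightSpace_iff, mem_weightSpace_iff]
  refine forall₂_congr fun t _ => ?_
  rw [Subtype.ext_iff, coe_weylRep_apply, Submodule.coe_smul]

/-- Weights along the coordinate isomorphism: `v` has weight `χ` in `(k^m)^{⊗n}` iff
`wordCoord v` has weight `χ` in the coordinate model (`wordCoord_glTensorRep`). [folklore] -/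
private theorem mem_weightSpace_glTensorRep_iff_wordCoord (χ : Weight (Fin m))
    (v : TensorPower k n (Fin m → k)) :
    v ∈ weightSpace (glTensorRep (Fin m) k n) χ ↔
      wordCoord k m n v ∈ weightSpace (wordRep k m n) χ := by
  rw [mem_weightSpace_iff, mem_weightSpace_iff]
  refine forall₂_congr fun t _ => ?_
  rw [← wordCoord_glTensorRep, ← map_smul, (wordCoord k m n).injective.eq_iff]

/-- **The slice space through IK's permutation matrices** (`|γ| = n`, characteristic zero):
`y ∈ sliceSpace k m n γ` iff `y` is supported on the words of content `γ` and fixed by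
`P_π = IK2020.permGL k π` for every `π ∈ stab γ` (from t08's generator description
`mem_sliceSpace_iff_forall_wordRep_eq`; `P_π` has matrix `permMatrix π⁻¹`, `IK2020.coe_permGL`).
[cite: IkenmeyerKandasamy2019, §10 (Claim 10.2)] -/
theorem mem_sliceSpace_iff_support_and_permGL [CharZero k] (γ : Fin m → ℕ) (hγ : ∑ i, γ i = n)
    (y : Word m n → k) :
    y ∈ sliceSpace k m n γ ↔ (∀ u : Word m n, wordContent u ≠ γ → y u = 0) ∧
      ∀ π : Equiv.Perm (Fin m), (∀ i, γ (π i) = γ i) →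
        wordRep k m n (IK2020.permGL k π) y = y := by
  constructor
  · intro hy
    refine ⟨((mem_sliceSpace_iff γ y).mp hy).1, fun π hπ => ?_⟩
    refine ((mem_sliceSpace_iff_forall_wordRep_eq k γ hγ y).mp hy).2 π⁻¹ (IK2020.permGL k π)
      (IK2020.coe_permGL π) fun i => ?_
    have := hπ (π⁻¹ i)
    rw [Equiv.Perm.inv_def, Equiv.apply_symm_apply] at this
    rw [Equiv.Perm.inv_def]
    exact this.symm
  · rintro ⟨hsupp, hperm⟩
    refine (mem_sliceSpace_iff_forall_wordRep_eq k γ hγ y).mpr ⟨fun d g hg hd => ?_, fun σ g hg hσ => ?_⟩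
    · have ht : IsDiagonalGL g := by
        rw [isDiagonalGL_iff_isDiag, hg]
        exact Matrix.isDiag_diagonal d
      funext w
      rw [wordRep_apply_of_isDiagonalGL k ht]
      by_cases hw : wordContent w = γ
      · rw [hw]
        have : (∏ i, (g : Matrix (Fin m) (Fin m) k) i i ^ γ i) = ∏ i, d i ^ γ i :=
          Finset.prod_congr rfl fun i _ => by rw [hg, Matrix.diagonal_apply_eq]
        rw [this, hd, one_mul]
      · rw [hsupp w hw, mul_zero]
    · have hgσ : g = IK2020.permGL k σ⁻¹ := by
        apply Units.ext
        rw [hg, IK2020.coe_permGL, inv_inv]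
      rw [hgσ]
      refine hperm σ⁻¹ fun i => ?_
      have := hσ (σ⁻¹ i)
      rw [Equiv.Perm.inv_def, Equiv.apply_symm_apply] at this
      rw [Equiv.Perm.inv_def]
      exact this.symm

end Transport

/-! ### §2 `({λ}^γ)^{stab γ}` in coordinates: `W_λ ⊓ X_γ = c_λ · X_γ` -/

section Main

variable (k : Type*) [Field k] [CharZero k] {m n : ℕ}

/-- **`wordCoord (({λ}^γ)^{stab γ}) = c_λ · sliceSpace γ`** (as subspaces of the coordinate
model; `|γ| = n`): the image of IK's `permFixed k λ (stab γ) ({λ}^γ)` under the inclusion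
`{λ} ⊆ (k^m)^{⊗n}` and the coordinate isomorphism is the image of the Young symmetrizer `c_λ`
acting on the slice space (computed inside the slice space and pushed to the ambient functions).
Route B of the val-lit note: weight `γ` ⟺ support on content-`γ` words, `P_π`-fixed ⟺
relabel-invariant, and `W_λ ⊓ X_γ = c_λ · X_γ` by `c_λ² = n_λ c_λ`.
[cite: IkenmeyerKandasamy2019, §10 (proof of Prop. 10.1)] [cite: FultonHarrisGTM129, Lemma 6.22] -/
theorem map_wordCoord_permFixed_weightSpace_eq (lam : Nat.Partition n) (γ : Fin m → ℕ)
    (hγ : ∑ i, γ i = n) :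
    ((IK2020.permFixed k lam {π | ∀ i, γ (π i) = γ i}
        (weightSpace (V := weylModule k (Fin m) lam) (weylRep k (Fin m) lam) (fun i => (γ i : ℤ)))).map
        (weylModule k (Fin m) lam).subtype).map (wordCoord k m n).toLinearMap =
      (LinearMap.range (((wordPermRep k m n).subrepresentation (sliceSpace k m n γ)
        (sliceSpace_le_comap k γ)).asAlgebraHom (youngSymmetrizer k lam))).map
        (sliceSpace k m n γ).subtype := by
  classical
  set c := youngSymmetrizer k lam with hc
  set nl : k := (c * c).coeff 1 with hnl
  have hnl0 : nl ≠ 0 := coeff_sq_youngSymmetrizer_ne_zero k lam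
  set A := (wordPermRep k m n).asAlgebraHom c with hA
  set X := sliceSpace k m n γ with hX
  set ρX := (wordPermRep k m n).subrepresentation X (sliceSpace_le_comap k γ) with hρX
  -- `A ∘ A = nl • A`
  have hAA : ∀ y, A (A y) = nl • A y := fun y => by
    rw [hA, ← Module.End.mul_apply, ← map_mul, youngSymmetrizer_sq, map_smul, LinearMap.smul_apply]
  ext y
  constructor
  · -- `⊆`
    rintro ⟨t, ⟨v, hv, rfl⟩, rfl⟩
    rw [SetLike.mem_coe, IK2020.permFixed, Submodule.mem_inf, Submodule.mem_iInf] at hv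
    obtain ⟨hvw, hvπ⟩ := hv
    -- the tensor `↑v` is `c · u`
    obtain ⟨u, hu⟩ := (LinearMap.mem_range.mp v.2 : (v : TensorPower k n (Fin m → k)) ∈
      LinearMap.range ((permTensorRep k (Fin m → k) n).asAlgebraHom c))
    set y := wordCoord k m n (v : TensorPower k n (Fin m → k)) with hy
    have hyA : y = A (wordCoord k m n u) := by
      rw [hy, ← hu, wordCoord_asAlgebraHom_permTensorRep_local]
    -- `y ∈ X`
    have hyX : y ∈ X := by
      refine (mem_sliceSpace_iff_support_and_permGL k γ hγ y).mpr ⟨?_, fun π hπ => ?_⟩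
      · exact (mem_weightSpace_wordRep_iff_support_local k γ y).mp
          ((mem_weightSpace_glTensorRep_iff_wordCoord k _ _).mp
            ((mem_weightSpace_weylRep_iff k lam _ v).mp hvw))
      · have h := hvπ π
        rw [Submodule.mem_iInf] at h
        have h' := h hπ
        rw [LinearMap.mem_eqLocus, LinearMap.id_apply, Subtype.ext_iff, coe_weylRep_apply] at h'
        rw [hy, ← wordCoord_glTensorRep, h']
    -- `y = A (nl⁻¹ • y)` with `nl⁻¹ • y ∈ X`
    refine ⟨ρX.asAlgebraHom c (nl⁻¹ • ⟨y, hyX⟩), LinearMap.mem_range_self _ _, ?_⟩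
    change ((ρX.asAlgebraHom c (nl⁻¹ • ⟨y, hyX⟩) : X) : Word m n → k) = _
    rw [coe_subrepresentation_asAlgebraHom, Submodule.coe_smul, map_smul]
    change nl⁻¹ • A y = (wordCoord k m n) (v : TensorPower k n (Fin m → k))
    rw [← hy, hyA, hAA, smul_smul, inv_mul_cancel₀ hnl0, one_smul]
  · -- `⊇`
    rintro ⟨z, ⟨x, rfl⟩, rfl⟩
    set y : Word m n → k := ((ρX.asAlgebraHom c x : X) : Word m n → k) with hy
    have hyX : y ∈ X := (ρX.asAlgebraHom c x).2
    have hyA : y = A (x : Word m n → k) := by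
      rw [hy, coe_subrepresentation_asAlgebraHom]
    -- the tensor with coordinates `y` lies in the Weyl module
    set t := (wordCoord k m n).symm y with ht
    have htW : t ∈ weylModule k (Fin m) lam := by
      refine ⟨(wordCoord k m n).symm (x : Word m n → k), ?_⟩
      apply (wordCoord k m n).injective
      rw [wordCoord_asAlgebraHom_permTensorRep_local, LinearEquiv.apply_symm_apply, ht,
        LinearEquiv.apply_symm_apply, hyA]
    have hty : wordCoord k m n t = y := by rw [ht, LinearEquiv.apply_symm_apply]
    obtain ⟨hsupp, hperm⟩ := (mem_sliceSpace_iff_support_and_permGL k γ hγ y).mp hyX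
    refine ⟨t, ⟨⟨t, htW⟩, ?_, rfl⟩, hty⟩
    rw [SetLike.mem_coe, IK2020.permFixed, Submodule.mem_inf, Submodule.mem_iInf]
    refine ⟨?_, fun π => ?_⟩
    · rw [mem_weightSpace_weylRep_iff, Submodule.coe_mk, mem_weightSpace_glTensorRep_iff_wordCoord,
        hty]
      exact (mem_weightSpace_wordRep_iff_support_local k γ y).mpr hsupp
    · rw [Submodule.mem_iInf]
      intro hπ
      rw [LinearMap.mem_eqLocus, LinearMap.id_apply, Subtype.ext_iff, coe_weylRep_apply,
        Submodule.coe_mk]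
      apply (wordCoord k m n).injective
      rw [wordCoord_glTensorRep, hty]
      exact hperm π hπ

/-- **`n! · dim ({λ}^γ)^{stab γ} = ∑_τ χ^λ(τ) χ_γ(τ)`** — the `[λ]`-multiplicity of the slice
space of content `γ` (`|γ| = n`, characteristic zero): Schur–Weyl duality for the weight space
`{λ}^γ` of the Weyl module and its `stab γ`-fixed vectors, IK 2020 §10 ("which by Schur–Weyl
duality equals … `{λ}^ϱ ≃ [λ]^{G_ϱ}`"), via `map_wordCoord_permFixed_weightSpace_eq` and the rank
formula for Young symmetrizers (`IK2020.factorial_mul_finrank_range_youngSymmetrizer`).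
[cite: IkenmeyerKandasamy2019, §10 (proof of Prop. 10.1)] [cite: FultonHarrisGTM129, Lemma 4.26] -/
theorem factorial_mul_finrank_permFixed_weightSpace_eq_sum (lam : Nat.Partition n) (γ : Fin m → ℕ)
    (hγ : ∑ i, γ i = n) :
    ((n.factorial : ℕ) : k) *
        (Module.finrank k (IK2020.permFixed k lam {π | ∀ i, γ (π i) = γ i}
          (weightSpace (V := weylModule k (Fin m) lam) (weylRep k (Fin m) lam) (fun i => (γ i : ℤ)))) : k) =
      ∑ τ : Equiv.Perm (Fin n), spechtCharacter k lam τ *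
        ((wordPermRep k m n).subrepresentation (sliceSpace k m n γ)
          (sliceSpace_le_comap k γ)).character τ := by
  rw [← IK2020.factorial_mul_finrank_range_youngSymmetrizer, ← Submodule.finrank_map_subtype_eq _
      (LinearMap.range _), ← map_wordCoord_permFixed_weightSpace_eq k lam γ hγ,
    LinearEquiv.finrank_map_eq, Submodule.finrank_map_subtype_eq]

end Main

/-! ### §3 IK 2020 Prop. 10.1: `dim ({λ}_ϱ)^{𝔖_m} = dim (HW_λ)^{K_{Dϱ}}`, and the reduction of the
named fact to the symmetric-group count (part P2) -/

section IK

open IK2020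

/-- The content vector `D·ϱ` (`ϱ ⊢ d` padded by zeros to `m` letters) has total content `dD` when
`ϱ` has at most `m` parts. [cite: IkenmeyerKandasamy2019, §10 (proof of Prop. 10.1)] -/
theorem IK2020.sum_mul_getD_sortedParts {m D d : ℕ} (ρ : Nat.Partition d) (hρ : ρ.parts.card ≤ m) :
    ∑ i : Fin m, D * ρ.sortedParts.getD (i : ℕ) 0 = d * D := by
  have h := Weight.size_ofPartition_holds (N := m) hρ
  unfold Weight.size at h
  simp only [Weight.ofPartition_apply] at h
  have h' : ∑ i : Fin m, ρ.sortedParts.getD (i : ℕ) 0 = d := by exact_mod_cast h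
  rw [← Finset.mul_sum, h', Nat.mul_comm]

/-- **IK 2020, proof of Prop. 10.1, the Schur–Weyl step**: for `λ ⊢_m dD`, `ϱ ⊢_m d`,
`(dD)! · dim ({λ}_ϱ)^{𝔖_m} = ∑_{τ ∈ 𝔖_{dD}} χ^λ(τ) χ_{Dϱ}(τ)`, `χ_{Dϱ}` the character of the slice
space of content `D·ϱ` (Claim 10.2 `IK2020_claim_10_2_holds` + the transport
`factorial_mul_finrank_permFixed_weightSpace_eq_sum`). Standing hypotheses `3 ≤ D ≤ m` of §§2–3
kept (used only through Claim 10.2). [cite: IkenmeyerKandasamy2019, Prop. 10.1 (proof, §10)] -/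
theorem IK2020.factorial_mul_finrank_permFixed_contentSubspace_eq_sum (m D d : ℕ) (hD : 3 ≤ D)
    (hDm : D ≤ m) (lam : Nat.Partition (d * D)) (hlam : lam.parts.card ≤ m)
    (ρ : Nat.Partition d) (hρ : ρ.parts.card ≤ m) :
    (((d * D).factorial : ℕ) : ℂ) *
        (Module.finrank ℂ (permFixed ℂ lam Set.univ (contentSubspace ℂ m D lam ρ)) : ℂ) =
      ∑ τ : Equiv.Perm (Fin (d * D)), spechtCharacter ℂ lam τ *
        ((wordPermRep ℂ m (d * D)).subrepresentation
          (sliceSpace ℂ m (d * D) fun i : Fin m => D * ρ.sortedParts.getD (i : ℕ) 0)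
          (sliceSpace_le_comap ℂ _)).character τ := by
  have hD0 : D ≠ 0 := by omega
  rw [IK2020_claim_10_2_holds m D d hD hDm lam hlam ρ hρ]
  have hS : {π : Equiv.Perm (Fin m) | ∀ i, Weight.ofPartition m ρ (π i) = Weight.ofPartition m ρ i} =
      {π | ∀ i : Fin m, D * ρ.sortedParts.getD (π i : ℕ) 0 = D * ρ.sortedParts.getD (i : ℕ) 0} := by
    ext π
    simp only [Set.mem_setOf_eq, Weight.ofPartition_apply, Nat.cast_inj]
    exact forall_congr' fun i => (Nat.mul_right_inj hD0).symm
  have hW : (fun i : Fin m => (D : ℤ) * Weight.ofPartition m ρ i) =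
      fun i : Fin m => ((D * ρ.sortedParts.getD (i : ℕ) 0 : ℕ) : ℤ) := by
    funext i
    rw [Weight.ofPartition_apply]
    push_cast
    ring
  rw [hS, hW]
  exact factorial_mul_finrank_permFixed_weightSpace_eq_sum ℂ lam _ (sum_mul_getD_sortedParts ρ hρ)

/-- **IK 2020 Prop. 10.1, left side = `dim (HW_λ)^{K_{Dϱ}(w₀)}`**: for every word `w₀` of content
`D·ϱ`, every subgroup `K ≤ 𝔖_{dD}` with `τ ∈ K ↔ ∃ σ, σ ∘ w₀ ∘ τ = w₀` (the Young–wreath subgroup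
`∏_i 𝔖_{ρ̂_i} ≀ 𝔖_{iD}` when `w₀` is a block word) and every `N ≥ ℓ(λ)`,
`dim ({λ}_ϱ)^{𝔖_m} = dim (HW_λ((ℂ^N)^{⊗dD}))^{K}` — the printed "`{λ}^ϱ ≃ [λ]^{G_ϱ}` [ike:12b,
4.3(A)] … Schur–Weyl duality" step, with val-lit t08's permutation-character identity
`sum_spechtCharacter_mul_character_sliceSpace_eq_finrank_invariants`.
[cite: IkenmeyerKandasamy2019, Prop. 10.1 (proof, §10)] -/
theorem IK2020.finrank_permFixed_contentSubspace_eq_finrank_invariants (m D d : ℕ) (hD : 3 ≤ D)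
    (hDm : D ≤ m) (lam : Nat.Partition (d * D)) (hlam : lam.parts.card ≤ m)
    (ρ : Nat.Partition d) (hρ : ρ.parts.card ≤ m) (w₀ : Word m (d * D))
    (hw₀ : wordContent w₀ = fun i : Fin m => D * ρ.sortedParts.getD (i : ℕ) 0)
    (K : Subgroup (Equiv.Perm (Fin (d * D))))
    (hK : ∀ τ, τ ∈ K ↔ ∃ σ : Equiv.Perm (Fin m), ⇑σ ∘ w₀ ∘ ⇑τ = w₀) {N : ℕ}
    (hN : lam.parts.card ≤ N) :
    Module.finrank ℂ (permFixed ℂ lam Set.univ (contentSubspace ℂ m D lam ρ)) =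
      Module.finrank ℂ (Representation.invariants
        ((hwPermRep ℂ (D := d * D) (Weight.ofPartition N lam)).comp K.subtype)) := by
  have h1 := factorial_mul_finrank_permFixed_contentSubspace_eq_sum m D d hD hDm lam hlam ρ hρ
  rw [sum_spechtCharacter_mul_character_sliceSpace_eq_finrank_invariants (k := ℂ) _ w₀ hw₀ K hK
    lam hN] at h1
  have hf : (((d * D).factorial : ℕ) : ℂ) ≠ 0 := Nat.cast_ne_zero.mpr (Nat.factorial_ne_zero _)
  exact_mod_cast mul_left_cancel₀ hf h1

/-- **The same count as a character sum over `K_{Dϱ}(w₀)`** (no alphabet `N`):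
`|K| · dim ({λ}_ϱ)^{𝔖_m} = ∑_{κ ∈ K_{Dϱ}(w₀)} χ^λ(κ)` (Fulton–Harris (2.9) for the permutation
module `ℂ[𝔖_{dD}/K]`; t08's `card_mul_sum_spechtCharacter_mul_character_sliceSpace`).
[cite: IkenmeyerKandasamy2019, Prop. 10.1 (proof, §10)] [cite: FultonHarrisGTM129, §2.2 (2.9)] -/
theorem IK2020.card_mul_finrank_permFixed_contentSubspace_eq_sum (m D d : ℕ) (hD : 3 ≤ D)
    (hDm : D ≤ m) (lam : Nat.Partition (d * D)) (hlam : lam.parts.card ≤ m)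
    (ρ : Nat.Partition d) (hρ : ρ.parts.card ≤ m) (w₀ : Word m (d * D))
    (hw₀ : wordContent w₀ = fun i : Fin m => D * ρ.sortedParts.getD (i : ℕ) 0) :
    ((Finset.univ.filter fun τ : Equiv.Perm (Fin (d * D)) =>
        ∃ σ : Equiv.Perm (Fin m), ⇑σ ∘ w₀ ∘ ⇑τ = w₀).card : ℂ) *
        (Module.finrank ℂ (permFixed ℂ lam Set.univ (contentSubspace ℂ m D lam ρ)) : ℂ) =
      ∑ τ ∈ Finset.univ.filter (fun τ : Equiv.Perm (Fin (d * D)) =>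
        ∃ σ : Equiv.Perm (Fin m), ⇑σ ∘ w₀ ∘ ⇑τ = w₀), spechtCharacter ℂ lam τ := by
  classical
  have h1 := factorial_mul_finrank_permFixed_contentSubspace_eq_sum m D d hD hDm lam hlam ρ hρ
  have h2 := card_mul_sum_spechtCharacter_mul_character_sliceSpace (k := ℂ) _ w₀ hw₀ lam
  rw [← h1, mul_left_comm] at h2
  have hf : (((d * D).factorial : ℕ) : ℂ) ≠ 0 := Nat.cast_ne_zero.mpr (Nat.factorial_ne_zero _)
  convert mul_left_cancel₀ hf h2 using 2

/-- **`IK2020_prop_10_1` reduced to the symmetric-group count (part P2 of the val-lit route)**: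
if for every admissible `(m, D, d, λ, ϱ)` some word `w₀` of content `D·ϱ`, subgroup
`K = K_{Dϱ}(w₀)` and alphabet `N ≥ ℓ(λ)` satisfy `dim (HW_λ((ℂ^N)^{⊗dD}))^K = b(λ,ϱ,D,d)`
(IK's `∑_{μ•} c^λ_{μ¹…μ^d} ∏ a_{μ^i}(ρ̂_i, iD)`, the tree's `IK2020.bCoeff`), then Prop. 10.1 holds.
[cite: IkenmeyerKandasamy2019, Prop. 10.1] -/
theorem IK2020_prop_10_1_of_finrank_invariants_eq_bCoeff
    (h : ∀ (m D d : ℕ), 3 ≤ D → D ≤ m → ∀ (lam : Nat.Partition (d * D)), lam.parts.card ≤ m →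
      ∀ (ρ : Nat.Partition d), ρ.parts.card ≤ m →
        ∃ (w₀ : Word m (d * D)) (K : Subgroup (Equiv.Perm (Fin (d * D)))) (N : ℕ),
          (wordContent w₀ = fun i : Fin m => D * ρ.sortedParts.getD (i : ℕ) 0) ∧
          (∀ τ, τ ∈ K ↔ ∃ σ : Equiv.Perm (Fin m), ⇑σ ∘ w₀ ∘ ⇑τ = w₀) ∧
          lam.parts.card ≤ N ∧
          Module.finrank ℂ (Representation.invariants
            ((hwPermRep ℂ (D := d * D) (Weight.ofPartition N lam)).comp K.subtype)) =
            bCoeff ℂ m D d lam ρ) :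
    IK2020_prop_10_1 := by
  intro m D d hD hDm lam hlam ρ hρ
  obtain ⟨w₀, K, N, hw₀, hK, hN, hb⟩ := h m D d hD hDm lam hlam ρ hρ
  rw [← hb]
  exact IK2020.finrank_permFixed_contentSubspace_eq_finrank_invariants m D d hD hDm lam hlam ρ hρ
    w₀ hw₀ K hK hN

end IK

end Literature.Computability.AlgebraicComplexity

end
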